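/-
Copyright (c) 2026 the pub-hodgecm-mathlib formalisation cell (harness21).  Prover seat hodgecm-mathlib-F0P2-p07 (g0), re-dealt to strike line L1
`stub_firstTermThetaPairing` (director s1970, LEAD F0P6-plan (g14) EMIT #1 «p18», BATCH #44 (1) «=»): Track B «K2-LIT», hLiu418 = stmt-HodgeConjecture-24832,
road `K2_Liu`, socket #42S, organ S1 ROAD W — the LETTERS of the ramified socket instance `K2LiuLocalSWSpanningRamified` at the character OF RECORD.
-/
import Summits.HodgeConjecture.HodgeConjecture.Theorems.K2LiuLocalSWRamifiedRankOneSign         -- ★ F7r-2 (the `χ_w⁻¹` sign; `detDelta`, `toLocalRing`, `isUnit_toLocalRing_coe`)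
import Literature.NumberTheory.QuadraticForms.HilbertSymbolRegularLocal                       -- ★ `isRegularHilbertField_adicCompletion` (bilinearity of `( , )_v`)
import HarnessLib

/-!
# Crux `HLiu418`, #42S organ S1, ROAD W, file R2-letters: THE RAMIFIED RELATIVE SIGN AT THE CHARACTER OF RECORD `(χ^{M₂})_w`, THE TWO QUADRATIC
# CURRENCIES `(δ², ·)_v = (·, θ)_v`, AND THE UNIT-STABILITY OF THE DUAL BOXES

Cell `hodgecm-mathlib`, crux item hLiu418 = `stmt-HodgeConjecture-24832`; squad K2 ∕ K2Liu; LEAD F0P6-plan (g14), S1 desk K2Liu-p08 (g5); prover F0P2-p07 (g0)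
(re-dealt seat).  THEOREMS ONLY (no `def`, no instance, no notation, no named-fact hypothesis, no `sorry`); lane `--supports stmt-HodgeConjecture-24832 --as helper`.

WHY.  The S1 face `hS1ns` of ★ (asm-3) TOP `K2LiuStdSectionCoherentExpansion.exists_coherentExpansion` is stated at the character OF RECORD `χv w = (χb^{M₂})_w`
(`χb` a weight-one splitting character, `M₂ = dim V′` odd) with the non-split ∕ sign conditions in the `θ = cmQuadraticGenerator` currency (`¬ IsSquare θ`, `(c₁, θ)_v = −1`),
while ★ F7r-2 `K2LiuLocalSWRamifiedRankOneSign` computes the ramified relative sign for `χv w = χ_w⁻¹` in the `δ² = imagUnitSq` currency of ★ (q4′).  This file supplies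
the three letters the ramified socket instance (sequel `K2LiuLocalSWSpanningRamified`) needs to run ★ F7r-1∕F7r-5 and ★ (asm-2) at the record data:
* §1 `exists_imagUnitSq_eq_cmQuadraticGenerator_mul_sq` (`δ² = θ·t²`), **`hilbertSymbol_imagUnitSq_eq`** (`(δ², x)_v = (x, θ)_v`), **`hilbertSymbol_mul_inv_eq_one`**
  (`(c₁·a⁻¹, δ²)_v = 1` when `(c₁, θ)_v = (δ², a)_v = −1`; bilinearity ★ `isRegularHilbertField_adicCompletion`) — the scalar hypothesis of ★ (asm-2)
  `localSWImage_record_eq_of_hilbertSymbol_eq_one` for the frames `a • dV₀`, `c₁ • dV₀`;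
* §2 **`localSiegelCharacter_pow_eq_neg_one_of_detDelta`** — THE SIGN `(χ^{M₂})_v(det_Δ ℓ₁)·|det_Δ ℓ₁|_v^{s+n∕2} = (χ_w(a⁻¹))^{M₂} = ((δ², a)_v)^{M₂} = −1` for `M₂` odd,
  `a` a `v`-unit with `(δ², a)_v = −1`, and every `ℓ₁` with `det_Δ(ℓ₁)_w = a_w⁻¹` (twin of ★ F7r-2 `localSiegelCharacter_eq_neg_one_of_detDelta`; ★
  `localComponent_inv_toPlace_eq_hilbertSymbol`) — the `hμ` of ★ F7r-5 `offBigCell_add_mul_localCongr_dA_eq_zero` with `μ = 1` and the factor `2` in `hsum`;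
* §3 **`smul_mem_box_iff`** — the dual boxes ★ (B) `K2LiuLocalSWDualBoxes` are stable under scalars of modulus one at every `w ∣ v` (so `Ad(d_a) n(t) = n(a⁻¹t)` permutes
  `N_{BOX m} ⧸ N_{BOX 0}`: hypotheses `hΛ₀`, `hΛ` of ★ F7r-1 `sum_weylDelta_witness_localCongr_dA` ∕ `localCongr_dA_mem_coordinate_iff`).
References: [HarrisKudlaSweet1996] §1 (1.5), (1.15); [Kudla1994] §3 Thm. 3.1; [KudlaSweet1997] §1; [Omeara1963] §63B; [BushnellHenniart2006] §1.1.
HONEST LABEL.  Count-neutral helper: `HC_CM` is proved only modulo the 7 printed citations (2 remaining named inputs: hLiu418 = `stmt-HodgeConjecture-24832`,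
h413 = `stmt-HodgeConjecture-24833`) until rung 0 closes.

## References
* [HarrisKudlaSweet1996] M. Harris, S. Kudla, W. J. Sweet, J. Amer. Math. Soc. 9 (1996), §1 (1.5), (1.15).
* [Kudla1994] S. S. Kudla, Israel J. Math. 87 (1994), §3 Thm. 3.1.
* [KudlaSweet1997] S. S. Kudla, W. J. Sweet, Israel J. Math. 98 (1997), §1.
* [Omeara1963] O. T. O'Meara, *Introduction to Quadratic Forms* (1963), §63B.
* [BushnellHenniart2006] C. J. Bushnell, G. Henniart, *The Local Langlands Conjecture for GL(2)* (2006), §1.1.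
-/

set_option autoImplicit false
set_option linter.dupNamespace false -- the mandated namespace repeats `HodgeConjecture.HodgeConjecture`

noncomputable section

open scoped Matrix
open NumberField IsDedekindDomain Matrix
open Literature.NumberTheory.QuadraticForms
open Literature.NumberTheory.Automorphic Literature.NumberTheory.Automorphic.UnitaryGroup Literature.NumberTheory.GaloisRepresentations
open Literature.RepresentationTheory.HarrisKudlaSweet1996
open Literature.NumberTheory.GelbartRogawski1991 Literature.NumberTheory.GelbartRogawski1991.GRConstruction
open Literature.NumberTheory.GelbartRogawski1991.AdaptedBlocks
open Literature.NumberTheory.GelbartRogawski1991.UnitaryDualPair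
open Literature.NumberTheory.GelbartRogawski1991.UnitaryDualPair.LocalSplitting
open Literature.NumberTheory.K2Lit.LocalSiegelDoubled
open Summit.HodgeConjecture.HodgeConjecture.Cruxes.HLiu418.K2LiuLocalSWSimilitudeAlgebra

namespace Summit.HodgeConjecture.HodgeConjecture.Cruxes.HLiu418.K2LiuLocalSWRamifiedRecordSign

/-! ## §1 The two quadratic currencies `(δ², ·)_v` and `(·, θ)_v`; the product `(c₁ a⁻¹, δ²)_v` -/

section Symbols

variable (L : Type) [Field L] [NumberField L] [IsCMField L] (v : HeightOneSpectrum (𝓞 (Fp L)))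

/-- `δ² = θ·t²` for some `t ∈ L⁺ˣ` (`δ = imagUnit L` and a square root `α` of `θ = cmQuadraticGenerator L` are both purely imaginary, so `δ∕α ∈ L⁺`).
[cite: Omeara1963, §63B] -/
theorem exists_imagUnitSq_eq_cmQuadraticGenerator_mul_sq :
    ∃ t : Fp L, t ≠ 0 ∧ (imagUnitSq L : Fp L) = (cmQuadraticGenerator L : Fp L) * t ^ 2 := by
  obtain ⟨α, hα0, hαc, hα⟩ := cmQuadraticGenerator_spec L
  have ht : IsCMField.complexConj L (imagUnit L / α) = imagUnit L / α := by
    rw [map_div₀, complexConj_imagUnit, hαc, neg_div_neg_eq]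
  refine ⟨⟨imagUnit L / α, (IsCMField.complexConj_eq_self_iff L _).1 ht⟩, fun h => ?_, ?_⟩
  · have h' : imagUnit L / α = 0 := congrArg Subtype.val h
    exact div_ne_zero (imagUnit_ne_zero L) hα0 h'
  · apply (algebraMap (Fp L) L).injective
    rw [map_mul, map_pow, ← hα, ← imagUnit_mul_self]
    change imagUnit L * imagUnit L = α ^ 2 * (imagUnit L / α) ^ 2
    field_simp

/-- **the two quadratic currencies agree**: `(δ², x)_v = (x, θ)_v` for every `x ∈ L⁺_v` (`δ² = θ·t²`, `t ≠ 0`; symmetry of the symbol).  The letters of ★ F7r-2 ∕ ★ (q4′)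
(`(δ², a)_v`) against those of ★ (asm-3) TOP's `hS1ns` (`(c₁, θ)_v`). [cite: Omeara1963, §63B] -/
theorem hilbertSymbol_imagUnitSq_eq (x : v.adicCompletion (Fp L)) :
    hilbertSymbol (v.adicCompletion (Fp L)) ((imagUnitSq L : Fp L) : v.adicCompletion (Fp L)) x =
      hilbertSymbol (v.adicCompletion (Fp L)) x (algebraMap (Fp L) (v.adicCompletion (Fp L)) (cmQuadraticGenerator L : Fp L)) := by
  obtain ⟨t, ht0, ht⟩ := exists_imagUnitSq_eq_cmQuadraticGenerator_mul_sq L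
  have htv : algebraMap (Fp L) (v.adicCompletion (Fp L)) t ≠ 0 := (_root_.map_ne_zero _).2 ht0
  have h1 : ((imagUnitSq L : Fp L) : v.adicCompletion (Fp L)) =
      algebraMap (Fp L) (v.adicCompletion (Fp L)) (cmQuadraticGenerator L : Fp L) * (algebraMap (Fp L) (v.adicCompletion (Fp L)) t) ^ 2 := by
    rw [← map_pow, ← map_mul, ← ht]; rfl
  rw [h1, hilbertSymbol_mul_sq_left _ _ htv, hilbertSymbol_comm]

/-- **`(c₁·a⁻¹, δ²)_v = 1`** when `(c₁, θ)_v = −1` and `(δ², a)_v = −1` (bilinearity of the local Hilbert symbol, ★ `isRegularHilbertField_adicCompletion`; §1 currencies).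
This is the scalar hypothesis of ★ (asm-2) `localSWImage_record_eq_of_hilbertSymbol_eq_one` for the frames `a • dV₀` and `c₁ • dV₀`. [cite: Omeara1963, §63B] [cite: Kudla1994, §3 Thm. 3.1] -/
theorem hilbertSymbol_mul_inv_eq_one {c₁ a : Fp L} (hc0 : c₁ ≠ 0) (ha0 : a ≠ 0)
    (hc₁ : hilbertSymbol (v.adicCompletion (Fp L)) (algebraMap (Fp L) _ c₁) (algebraMap (Fp L) _ (cmQuadraticGenerator L : Fp L)) = -1)
    (ha : hilbertSymbol (v.adicCompletion (Fp L)) ((imagUnitSq L : Fp L) : v.adicCompletion (Fp L)) ((a : Fp L) : v.adicCompletion (Fp L)) = -1) :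
    hilbertSymbol (v.adicCompletion (Fp L)) (((c₁ * a⁻¹ : Fp L) : Fp L) : v.adicCompletion (Fp L)) ((imagUnitSq L : Fp L) : v.adicCompletion (Fp L)) = 1 := by
  have hcv : (algebraMap (Fp L) (v.adicCompletion (Fp L)) c₁) ≠ 0 := (_root_.map_ne_zero _).2 hc0
  have hav : algebraMap (Fp L) (v.adicCompletion (Fp L)) a ≠ 0 := (_root_.map_ne_zero (algebraMap (Fp L) (v.adicCompletion (Fp L)))).2 ha0
  have hθ : algebraMap (Fp L) (v.adicCompletion (Fp L)) (cmQuadraticGenerator L : Fp L) ≠ 0 :=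
    (_root_.map_ne_zero _).2 fun h => not_isSquare_cmQuadraticGenerator L (by rw [h]; exact IsSquare.zero)
  have ha' : hilbertSymbol (v.adicCompletion (Fp L)) (algebraMap (Fp L) (v.adicCompletion (Fp L)) a) (algebraMap (Fp L) _ (cmQuadraticGenerator L : Fp L)) = -1 := by
    rw [← hilbertSymbol_imagUnitSq_eq]; exact ha
  have hcast : (((c₁ * a⁻¹ : Fp L) : Fp L) : v.adicCompletion (Fp L)) =
      algebraMap (Fp L) (v.adicCompletion (Fp L)) c₁ * (algebraMap (Fp L) (v.adicCompletion (Fp L)) a)⁻¹ := by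
    rw [← map_inv₀, ← map_mul]; rfl
  rw [hcast, hilbertSymbol_comm, hilbertSymbol_imagUnitSq_eq,
    (isRegularHilbertField_adicCompletion (Fp L) v).mul_left _ _ _ hcv (inv_ne_zero hav) hθ, hilbertSymbol_inv_left hav, hc₁, ha']
  norm_num

end Symbols

/-! ## §2 The sign at the character of record `(χ^{M₂})_w`, `M₂` odd -/

section Sign

variable (L : Type) [Field L] [NumberField L] [IsCMField L] (v : HeightOneSpectrum (𝓞 (Fp L))) (n : ℕ)
  {T₀ : Matrix (Fin n) (Fin n) (Fp L)} (hT₀ : T₀.IsSymm)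
  {JD : Matrix (Fin (n + n)) (Fin (n + n)) L} (hJD : JD = (gramD (Fp L) n T₀).map (algebraMap (Fp L) L))
  (χ : HeckeCharacter L) (hχ : IsSplittingChar L 1 χ) {M₂ : ℕ} (hM₂ : Odd M₂) (s : ℂ)
  (w₀ : PlacesOver L v) (hw₀ : IsCMField.complexConj L • w₀.1 = w₀.1)
  (a : (Fp L)ˣ)
  (ha₁ : ‖toPlace v w₀ ((a : Fp L) : v.adicCompletion (Fp L))‖ = 1)
  (ha : hilbertSymbol (v.adicCompletion (Fp L)) ((imagUnitSq L : Fp L) : v.adicCompletion (Fp L)) ((a : Fp L) : v.adicCompletion (Fp L)) = -1)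

include hχ hM₂ hw₀ ha₁ ha in
/-- **THE SIGN AT THE CHARACTER OF RECORD.**  `L` CM, `χ` a weight-one splitting character (`χ_w⁻¹|_{L⁺_vˣ} = (δ², ·)_v` at a non-split `w`, ★
`localComponent_inv_toPlace_eq_hilbertSymbol`), `M₂` ODD, `a ∈ L⁺` a `v`-adic unit with `(δ², a)_v = −1`.  For every `ℓ₁ ∈ U(J_D)(L⁺_v)` with `det_Δ(ℓ₁)_w = a_w⁻¹`
(the Levi letter of a rank-one Weyl word under `Ad(d_a)`) and every `s`: `(χ^{M₂})_v(det_Δ ℓ₁)·|det_Δ ℓ₁|_v^{s+n∕2} = (χ_w(a⁻¹))^{M₂} = ((δ², a)_v)^{M₂} = −1`.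
[cite: HarrisKudlaSweet1996, §1 (1.5), (1.15)] [cite: Kudla1994, §3 Thm. 3.1] -/
theorem localSiegelCharacter_pow_eq_neg_one_of_detDelta {ℓ₁ : UnitaryGroup.localPi L (IsCMField.complexConj L) (n + n) JD v}
    (hdet₁ : ∀ w, detDelta (Fp L) L (IsCMField.complexConj L) v n w ℓ₁ =
      toLocalRing L v (((a⁻¹ : (Fp L)ˣ) : Fp L) : v.adicCompletion (Fp L)) w) :
    localSiegelCharacter (Fp L) L (IsCMField.complexConj L) v n (fun w => (χ ^ M₂).localComponent w.1) s ℓ₁ = -1 := by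
  classical
  haveI : Subsingleton (PlacesOver L v) :=
    PlacesOver.subsingleton_of_smul_eq (IsCMField.complexConj L) (IsCMField.complexConj_ne_one L) w₀ hw₀
  set Kv := v.adicCompletion (Fp L)
  have ha0 : ((a : Fp L) : Kv) ≠ 0 := (map_ne_zero (algebraMap (Fp L) Kv)).2 a.ne_zero
  set aK : Kvˣ := Units.mk0 ((a : Fp L) : Kv) ha0 with haK
  have hinv : (((a⁻¹ : (Fp L)ˣ) : Fp L) : Kv) = ((aK⁻¹ : Kvˣ) : Kv) := by
    rw [Units.val_inv_eq_inv_val aK, haK, Units.val_mk0, Units.val_inv_eq_inv_val]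
    exact map_inv₀ (algebraMap (Fp L) Kv) _
  have hu : IsUnit (detDelta (Fp L) L (IsCMField.complexConj L) v n w₀ ℓ₁) := by
    rw [hdet₁ w₀]; exact (isUnit_toLocalRing_coe (Fp L) L v a⁻¹).map (Pi.evalRingHom _ w₀)
  have hunit : hu.unit = Units.map (toPlace v w₀ : Kv →+* w₀.1.adicCompletion L).toMonoidHom aK⁻¹ := by
    ext
    rw [IsUnit.unit_spec, hdet₁ w₀, toLocalRing_apply, hinv, Units.coe_map, RingHom.toMonoidHom_eq_coe, MonoidHom.coe_coe]
  -- `χ_w(a⁻¹) = ((δ², a⁻¹)_v)⁻¹ = −1`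
  have hε := localComponent_inv_toPlace_eq_hilbertSymbol χ hχ w₀ hw₀ aK⁻¹
  have hsym : hilbertSymbol Kv ((imagUnitSq L : Fp L) : Kv) ((aK⁻¹ : Kvˣ) : Kv) = -1 := by
    rw [Units.val_inv_eq_inv_val, haK, Units.val_mk0, hilbertSymbol_inv_right _ ha0, ha]
  have hχval : (((χ.localComponent w₀.1) (Units.map (toPlace v w₀ : Kv →+* w₀.1.adicCompletion L).toMonoidHom aK⁻¹) : ℂˣ) : ℂ) = -1 := by
    have h1 : ((((χ.localComponent w₀.1)⁻¹ : (w₀.1.adicCompletion L)ˣ →* ℂˣ)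
        (Units.map (toPlace v w₀ : Kv →+* w₀.1.adicCompletion L).toMonoidHom aK⁻¹) : ℂˣ) : ℂ) = -1 := by
      refine hε.trans ?_
      rw [hsym]; norm_num
    rw [MonoidHom.inv_apply, Units.val_inv_eq_inv_val, inv_eq_iff_eq_inv] at h1
    rw [h1]; norm_num
  have hval : ((((χ ^ M₂).localComponent w₀.1) hu.unit : ℂˣ) : ℂ) = -1 := by
    rw [hunit, HeckeCharacter.localComponent_apply, HeckeCharacter.pow_apply, ← HeckeCharacter.localComponent_apply, Units.val_pow_eq_pow_val, hχval,
      hM₂.neg_one_pow]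
  -- the modulus
  have hnorm : ‖detDelta (Fp L) L (IsCMField.complexConj L) v n w₀ ℓ₁‖ = 1 := by
    rw [hdet₁ w₀, toLocalRing_apply, hinv, Units.val_inv_eq_inv_val, map_inv₀, norm_inv, haK, Units.val_mk0, ha₁, inv_one]
  unfold localSiegelCharacter LocalSplitting.chiDet absDetDelta
  rw [Fintype.prod_subsingleton _ w₀, Fintype.prod_subsingleton _ w₀, dif_pos hu, hval, hnorm, Complex.ofReal_one, Complex.one_cpow, mul_one]

end Sign

/-! ## §3 The dual boxes are stable under unit scalars of modulus one -/

section Boxes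

variable (F : Type) [Field F] [NumberField F] (E : Type) [Field E] [NumberField E] [Algebra F E]
  (v : HeightOneSpectrum (𝓞 F)) (π : v.adicCompletion F) {T₀ : Matrix (Fin 2) (Fin 2) F} (δ : E) (c₀ e₂ m : ℤ)

/-- **`BOX m` is stable under a scalar `s ∈ E ⊗ F_v` with `|s_w|_w = 1` at every `w ∣ v`**: `s • t ∈ BOX m ↔ t ∈ BOX m` (every coordinate condition is a valuation
bound on `(δ·𝕋₀·t)_{ij,w}`, and `(δ·𝕋₀·(s•t))_{ij,w} = s_w·(δ·𝕋₀·t)_{ij,w}`).  With `s = a⁻¹` for a `v`-adic unit `a ∈ L⁺` these are the hypotheses `hΛ₀`, `hΛ` of ★ F7r-1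
`sum_weylDelta_witness_localCongr_dA` ∕ `localCongr_dA_mem_coordinate_iff` (`Ad(d_a) n(t) = n(a⁻¹t)`). [cite: KudlaSweet1997, §1] [cite: BushnellHenniart2006, §1.1] -/
theorem smul_mem_box_iff {s : LocalRing E v} (hs : ∀ w : PlacesOver E v, Valued.v (s w) = 1) (t : Matrix (Fin 2) (Fin 2) (LocalRing E v)) :
    s • t ∈ {t : Matrix (Fin 2) (Fin 2) (LocalRing E v) | ∀ i j (w : PlacesOver E v),
        Valued.v ((algebraMap E (LocalRing E v) δ • (gramS F E v 2 T₀ * t)) i j w) ≤ Valued.v (toPlace v w π) ^ (c₀ - m - if i = j then e₂ else 0)} ↔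
      t ∈ {t : Matrix (Fin 2) (Fin 2) (LocalRing E v) | ∀ i j (w : PlacesOver E v),
        Valued.v ((algebraMap E (LocalRing E v) δ • (gramS F E v 2 T₀ * t)) i j w) ≤ Valued.v (toPlace v w π) ^ (c₀ - m - if i = j then e₂ else 0)} := by
  have key : ∀ i j (w : PlacesOver E v), Valued.v ((algebraMap E (LocalRing E v) δ • (gramS F E v 2 T₀ * (s • t))) i j w) =
      Valued.v ((algebraMap E (LocalRing E v) δ • (gramS F E v 2 T₀ * t)) i j w) := by
    intro i j w
    rw [Matrix.mul_smul, smul_comm, Matrix.smul_apply, smul_eq_mul, Pi.mul_apply, map_mul, hs w, one_mul]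
  simp only [Set.mem_setOf_eq, key]

end Boxes

end Summit.HodgeConjecture.HodgeConjecture.Cruxes.HLiu418.K2LiuLocalSWRamifiedRecordSign

end
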